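import Literature.NumberTheory.LFunctions.ClassGroupSiftedSums
import Literature.NumberTheory.LFunctions.RayClassLSeriesConvexity
import Literature.NumberTheory.LFunctions.RayClassConductor
import Literature.NumberTheory.LFunctions.CyclicExtensionHeckeFactorisation
import Literature.NumberTheory.LFunctions.AbelianFrobeniusDensity
import HarnessLib

/-!
# Smoothed character sums for a congruence class group `mod 𝔪` (Thorner–Zaman 2017, Lemma 4.3)

Topic `Literature/NumberTheory/LFunctions`, namespace `Literature.NumberTheory.LFunctions.AbelianDensity`.
Everything here is PROVED (one definition with body, theorems; no named facts).

The tree's `ClassGroupSmoothedSums.lean` proves Thorner–Zaman's Lemma 4.4 for the characters of the class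
group (`H = P_K`, modulus `1`).  This file is the first step of the same programme for an arbitrary
modulus: an *abelian Frobenius datum* `mod 𝔪` is a map `f` from the primes of `K` to a finite abelian group
`G` whose multiplicative extension kills the narrow ray `P^𝔪` (`ArtinKillsRay 𝔪 f`) — for `G = Cl_K^𝔪`,
`f 𝔭 = [𝔭]` this is the family of ALL ray class characters `mod 𝔪` (`PrimesInRayClasses.lean`), and in
general the characters of a congruence class group `H ⊇ P^𝔪` (Thorner–Zaman's `χ (mod H)`).  For a
character `χ` of `G` the function `ψ_χ(𝔭) = χ(f 𝔭)` is a ray class character `mod 𝔪`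
(`isRayClassCharacter_toMulHom`), with L-series `L_𝔪(s, ψ_χ)`.  With Weiss's kernel `φ = φ_{m+1}`
(parameter `A`, `m ≥ n_K + 3`) and `S_χ(u) = Σ_𝔞 χ(𝔞) N𝔞^{-1} φ(u − log N𝔞)` (`smoothedSum` of the
Dirichlet coefficients of `L_𝔪(s, ψ_χ)`):
* (private) `prod_one_add_sqrt_absNorm_le` — the imprimitive Euler factors on `Re s ≥ −1/2`:
  `∏_{𝔭 ∈ T} (1 + √N𝔭) ≤ N𝔪 √N𝔪` for any set `T` of prime divisors of `𝔪`;
* `norm_smoothedSum_charFun_le` — **TZ Lemma 4.3, non-principal case**: if `χ(f 𝔭) ≠ 1` for some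
  `𝔭 ∤ 𝔪`, then `|S_χ(u)| ≤ (1/3)·|d_K| N𝔪² √N𝔪 · e^{2n_K} · C · e^{−3u/2}` (`C = majorConst A m (n_K+1)`),
  via the primitive associate `χ₀ mod 𝔣` (`exists_primitive_associate`), Rademacher's convexity bound for
  `L(s, χ₀)` (`exists_continuation_norm_le`) and the Mellin shift `WeissKernel.norm_smoothedSum_sub_le`;
* `coprimeResidue K 𝔪 = κ_K ∏_{𝔭 ∣ 𝔪} (1 − N𝔭⁻¹)` (`= κ_K φ(𝔪)/N𝔪`), the residue at `s = 1` of
  `ζ_K(s) ∏_{𝔭∣𝔪}(1 − N𝔭^{-s}) = Σ_{(𝔞,𝔪)=1} N𝔞^{-s}`, and `rayClassLSeries_one_eq_dedekindZeta_mul_prod` —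
  `L_𝔪(s, 1) = ζ_K(s) ∏_{𝔭 ∣ 𝔪}(1 − N𝔭^{-s})` (`Re s > 1`);
* `norm_smoothedSum_one_sub_coprimeResidue_le` — **TZ Lemma 4.3, principal case**:
  `|S_1(u) − κ_K φ(𝔪)/N𝔪| ≤ (1/3)·|d_K| N𝔪 √N𝔪 · e^{2n_K} · C · e^{−3u/2}`.
The sizes are those of Thorner–Zaman up to the shape of the constants (`D_K^{1/2}Q^{1/2}` there, from a
shift to `Re s = −1/2 ± ε` with the sharp convexity exponent; here the tree's uniform convexity bound on
`Re s ≥ −1/2` with the line `Re s = 3/2` of `norm_smoothedSum_sub_le`).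

## References
* [ThornerZaman2017] J. Thorner, A. Zaman, *An explicit bound for the least prime ideal in the Chebotarev
  density theorem*, Algebra Number Theory 11 (2017), Lemma 4.3.
* [Weiss1983] A. Weiss, *The least prime ideal*, J. reine angew. Math. 338 (1983), Lemma 3.4.
* [NeukirchANT1999] J. Neukirch, *Algebraic Number Theory*, Ch. VII §8 (8.1), remark before (8.5).
-/

noncomputable section

open Complex Finset IsDedekindDomain NumberField Filter
open scoped Topology

namespace Literature.NumberTheory.LFunctions.AbelianDensity

open Literature.NumberTheory.LFunctions.WeissKernel Literature.NumberTheory.LFunctions.NumberField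
open scoped nonZeroDivisors _root_.NumberField Classical

variable {K : Type*} [Field K] [NumberField K]

/-! ### The imprimitive Euler factors -/

/-- For a real number `N ≥ 2`: `(1 + √N)² ≤ N³`. [folklore] -/
private theorem one_add_sqrt_sq_le {N : ℝ} (hN : 2 ≤ N) : (1 + Real.sqrt N) ^ 2 ≤ N ^ 3 := by
  have h0 : 0 ≤ Real.sqrt N := Real.sqrt_nonneg N
  have hsq : Real.sqrt N ^ 2 = N := Real.sq_sqrt (by linarith)
  have h1 : Real.sqrt N ≤ N := by nlinarith
  have hNN : 4 ≤ N * N := by nlinarith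
  have h3 : 4 * N ≤ N ^ 3 := by nlinarith
  calc (1 + Real.sqrt N) ^ 2 = 1 + 2 * Real.sqrt N + Real.sqrt N ^ 2 := by ring
    _ = 1 + 2 * Real.sqrt N + N := by rw [hsq]
    _ ≤ 1 + 3 * N := by linarith
    _ ≤ N ^ 3 := by linarith

/-- `‖N𝔭^{-z}‖ ≤ √N𝔭` for `Re z ≥ −1/2`. [folklore] -/
private theorem norm_absNorm_cpow_neg_le_sqrt (v : HeightOneSpectrum (𝓞 K)) {z : ℂ} (hz : -1 / 2 ≤ z.re) :
    ‖((Ideal.absNorm v.asIdeal : ℕ) : ℂ) ^ (-z)‖ ≤ Real.sqrt (Ideal.absNorm v.asIdeal : ℕ) := by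
  have hN : 0 < Ideal.absNorm v.asIdeal := Nat.pos_of_ne_zero (by
    rw [Ne, Ideal.absNorm_eq_zero_iff]; exact v.ne_bot)
  have hN1 : (1 : ℝ) ≤ (Ideal.absNorm v.asIdeal : ℕ) := by exact_mod_cast hN
  rw [Complex.norm_natCast_cpow_of_pos hN, Complex.neg_re, Real.sqrt_eq_rpow]
  exact Real.rpow_le_rpow_of_exponent_le hN1 (by linarith)

/-- `‖1 − c · N𝔭^{-z}‖ ≤ 1 + √N𝔭` for `|c| ≤ 1`, `Re z ≥ −1/2`. [folklore] -/
private theorem norm_one_sub_mul_cpow_le {c : ℂ} (hc : ‖c‖ ≤ 1) (v : HeightOneSpectrum (𝓞 K)) {z : ℂ}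
    (hz : -1 / 2 ≤ z.re) :
    ‖1 - c * ((Ideal.absNorm v.asIdeal : ℕ) : ℂ) ^ (-z)‖ ≤ 1 + Real.sqrt (Ideal.absNorm v.asIdeal : ℕ) := by
  have h := norm_absNorm_cpow_neg_le_sqrt v hz
  calc ‖1 - c * ((Ideal.absNorm v.asIdeal : ℕ) : ℂ) ^ (-z)‖
      ≤ ‖(1 : ℂ)‖ + ‖c * ((Ideal.absNorm v.asIdeal : ℕ) : ℂ) ^ (-z)‖ := norm_sub_le _ _
    _ = 1 + ‖c‖ * ‖((Ideal.absNorm v.asIdeal : ℕ) : ℂ) ^ (-z)‖ := by rw [norm_one, norm_mul]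
    _ ≤ 1 + 1 * Real.sqrt (Ideal.absNorm v.asIdeal : ℕ) := by gcongr
    _ = 1 + Real.sqrt (Ideal.absNorm v.asIdeal : ℕ) := by rw [one_mul]

/-- The product of the norms of distinct prime divisors of `𝔪 ≠ 0` is at most `N𝔪`. [folklore] -/
private theorem prod_absNorm_le_of_subset_factors {𝔪 : Ideal (𝓞 K)} (h𝔪 : 𝔪 ≠ ⊥)
    {T : Finset (HeightOneSpectrum (𝓞 K))} (hT : ∀ v ∈ T, v.asIdeal ∣ 𝔪) :
    ∏ v ∈ T, ((Ideal.absNorm v.asIdeal : ℕ) : ℝ) ≤ (Ideal.absNorm 𝔪 : ℕ) := by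
  have hdvd : sqfIdeal T ∣ 𝔪 := (sqfIdeal_dvd_iff T 𝔪).mpr hT
  have hN : Ideal.absNorm (sqfIdeal T) ∣ Ideal.absNorm 𝔪 := map_dvd Ideal.absNorm hdvd
  have hm0 : Ideal.absNorm 𝔪 ≠ 0 := by rwa [Ne, Ideal.absNorm_eq_zero_iff]
  have hle : Ideal.absNorm (sqfIdeal T) ≤ Ideal.absNorm 𝔪 := Nat.le_of_dvd (Nat.pos_of_ne_zero hm0) hN
  have hle' : ((Ideal.absNorm (sqfIdeal T) : ℕ) : ℝ) ≤ ((Ideal.absNorm 𝔪 : ℕ) : ℝ) := by exact_mod_cast hle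
  have heq : ((Ideal.absNorm (sqfIdeal T) : ℕ) : ℝ) = ∏ v ∈ T, ((Ideal.absNorm v.asIdeal : ℕ) : ℝ) := by
    rw [sqfIdeal, map_prod, Nat.cast_prod]
  rwa [heq] at hle'

/-- **The imprimitive Euler factors**: for a set `T` of prime divisors of `𝔪 ≠ 0`,
`∏_{𝔭 ∈ T} (1 + √N𝔭) ≤ N𝔪 · √N𝔪` (squares: `(1 + √N𝔭)² ≤ N𝔭³` and `∏_{𝔭∈T} N𝔭 ≤ N𝔪`). [folklore] -/
private theorem prod_one_add_sqrt_absNorm_le {𝔪 : Ideal (𝓞 K)} (h𝔪 : 𝔪 ≠ ⊥)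
    {T : Finset (HeightOneSpectrum (𝓞 K))} (hT : ∀ v ∈ T, v.asIdeal ∣ 𝔪) :
    ∏ v ∈ T, (1 + Real.sqrt (Ideal.absNorm v.asIdeal : ℕ)) ≤
      (Ideal.absNorm 𝔪 : ℕ) * Real.sqrt (Ideal.absNorm 𝔪 : ℕ) := by
  have h2 : ∀ v : HeightOneSpectrum (𝓞 K), (2 : ℝ) ≤ (Ideal.absNorm v.asIdeal : ℕ) := fun v ↦ by
    exact_mod_cast two_le_absNorm K v
  set M : ℝ := ((Ideal.absNorm 𝔪 : ℕ) : ℝ) with hM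
  have hM0 : 0 ≤ M := by positivity
  have hsq : (∏ v ∈ T, (1 + Real.sqrt (Ideal.absNorm v.asIdeal : ℕ))) ^ 2 ≤ (M * Real.sqrt M) ^ 2 := by
    rw [← prod_pow, mul_pow, Real.sq_sqrt hM0, show M ^ 2 * M = M ^ 3 by ring]
    calc ∏ v ∈ T, (1 + Real.sqrt (Ideal.absNorm v.asIdeal : ℕ)) ^ 2
        ≤ ∏ v ∈ T, ((Ideal.absNorm v.asIdeal : ℕ) : ℝ) ^ 3 :=
          prod_le_prod (fun v _ ↦ by positivity) (fun v _ ↦ one_add_sqrt_sq_le (h2 v))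
      _ = (∏ v ∈ T, ((Ideal.absNorm v.asIdeal : ℕ) : ℝ)) ^ 3 := (prod_pow _ _ _)
      _ ≤ M ^ 3 := by
          have h := prod_absNorm_le_of_subset_factors h𝔪 hT
          have h0 : 0 ≤ ∏ v ∈ T, ((Ideal.absNorm v.asIdeal : ℕ) : ℝ) := prod_nonneg fun v _ ↦ by positivity
          exact pow_le_pow_left₀ h0 h 3
  exact (pow_le_pow_iff_left₀ (prod_nonneg fun v _ ↦ by positivity) (by positivity) two_ne_zero).mp hsq

/-- The norm of the product of imprimitive Euler factors on `Re z ≥ −1/2`. [folklore] -/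
private theorem norm_prod_one_sub_mul_cpow_le {𝔪 : Ideal (𝓞 K)} (h𝔪 : 𝔪 ≠ ⊥)
    {T : Finset (HeightOneSpectrum (𝓞 K))} (hT : ∀ v ∈ T, v.asIdeal ∣ 𝔪) {c : HeightOneSpectrum (𝓞 K) → ℂ}
    (hc : ∀ v ∈ T, ‖c v‖ ≤ 1) {z : ℂ} (hz : -1 / 2 ≤ z.re) :
    ‖∏ v ∈ T, (1 - c v * ((Ideal.absNorm v.asIdeal : ℕ) : ℂ) ^ (-z))‖ ≤
      (Ideal.absNorm 𝔪 : ℕ) * Real.sqrt (Ideal.absNorm 𝔪 : ℕ) := by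
  refine (Finset.norm_prod_le _ _).trans (((prod_le_prod (fun v _ ↦ norm_nonneg _)
    (fun v hv ↦ norm_one_sub_mul_cpow_le (hc v hv) v hz))).trans (prod_one_add_sqrt_absNorm_le h𝔪 hT))

/-! ### The non-principal character sums (TZ Lemma 4.3, `δ(χ) = 0`) -/

section Datum

variable {G : Type*} [CommGroup G] [Finite G] {𝔪 : Ideal (𝓞 K)} {f : HeightOneSpectrum (𝓞 K) → G}

/-- `ψ_χ = χ ∘ f` is a ray class character `mod 𝔪` (restatement of `isRayClassCharacter_toMulHom` for
`charFun`). [folklore] -/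
private theorem isRayClassCharacter_charFun (hray : ArtinKillsRay 𝔪 f) (χ : AddChar (Additive G) ℂ) :
    IsRayClassCharacter 𝔪 (charFun f χ) :=
  isRayClassCharacter_toMulHom hray χ

/-- `‖z − 1‖ ≤ ‖z + 5/2‖` for `Re z ≥ −1/2`. [folklore] -/
private theorem norm_sub_one_le_norm_add {z : ℂ} (hz : -1 / 2 ≤ z.re) : ‖z - 1‖ ≤ ‖z + 5 / 2‖ := by
  rw [← Real.sqrt_sq (norm_nonneg (z - 1)), ← Real.sqrt_sq (norm_nonneg (z + 5 / 2))]
  refine Real.sqrt_le_sqrt ?_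
  rw [Complex.sq_norm, Complex.sq_norm, Complex.normSq_apply, Complex.normSq_apply]
  simp only [sub_re, one_re, sub_im, one_im, sub_zero, add_re, add_im]
  norm_num
  nlinarith

/-- **Thorner–Zaman Lemma 4.3 for a non-principal character of a congruence class group `mod 𝔪`.**
For an abelian Frobenius datum `f` killing the ray `mod 𝔪 ≠ 0`, a character `χ` of `G` with
`χ(f 𝔭) ≠ 1` for some `𝔭 ∤ 𝔪`, Weiss's kernel of order `m + 1 ≥ n_K + 4` with parameter `A > 0`, and every
real `u` (`x = e^u`): `|Σ_𝔞 ψ_χ(𝔞) N𝔞^{-1} φ(u − log N𝔞)| ≤ (1/3)·|d_K| N𝔪² √N𝔪 · e^{2n_K} · C · e^{−3u/2}`,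
`C = majorConst A m (n_K + 1)`. [cite: ThornerZaman2017, Lemma 4.3] -/
theorem norm_smoothedSum_charFun_le (h𝔪 : 𝔪 ≠ ⊥) (hray : ArtinKillsRay 𝔪 f) (χ : AddChar (Additive G) ℂ)
    (hnt : ∃ v : HeightOneSpectrum (𝓞 K), ¬ 𝔪 ≤ v.asIdeal ∧ χ (Additive.ofMul (f v)) ≠ 1)
    {A : ℝ} (hA : 0 < A) {m : ℕ} (hm : Module.finrank ℚ K + 3 ≤ m) (u : ℝ) :
    ‖smoothedSum (fun n ↦ ∑ I ∈ (Ideal.finite_setOf_absNorm_eq (S := 𝓞 K) n).toFinset,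
        rayClassCoeff 𝔪 (charFun f χ) I) A m u‖ ≤
      1 / 3 * ((((NumberField.discr K).natAbs : ℝ) * ((Ideal.absNorm 𝔪 : ℕ) : ℝ) ^ 2 *
        Real.sqrt (Ideal.absNorm 𝔪 : ℕ)) * Real.exp (2 * Module.finrank ℚ K)) *
        majorConst A m (Module.finrank ℚ K + 1) * Real.exp (-(3 / 2 * u)) := by
  set n : ℕ := Module.finrank ℚ K with hn
  set ψ := charFun f χ with hψdef
  have hψ : IsRayClassCharacter 𝔪 ψ := isRayClassCharacter_charFun hray χ
  obtain ⟨𝔣, χ₀, p, h𝔪𝔣, h𝔣, hχ₀, hprim, hp₀, -, hagree, hL⟩ := exists_primitive_associate hψ h𝔪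
  -- `χ₀` is non-principal on the primes `∤ 𝔣`
  obtain ⟨v₀, hv₀, hv₀1⟩ := hnt
  have hnt₀ : ∃ v : HeightOneSpectrum (𝓞 K), ¬ 𝔣 ≤ v.asIdeal ∧ χ₀ v ≠ 1 :=
    ⟨v₀, fun h ↦ hv₀ (h𝔪𝔣.trans h), by rw [hagree v₀ hv₀]; exact hv₀1⟩
  obtain ⟨L, hLd, hLs, hLb⟩ := exists_continuation_norm_le hχ₀ hprim hp₀ h𝔣 hnt₀
  -- the imprimitive Euler factors
  set T := (Ideal.finite_factors h𝔪).toFinset.filter (fun v ↦ ¬ 𝔣 ≤ v.asIdeal) with hT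
  have hTdvd : ∀ v ∈ T, v.asIdeal ∣ 𝔪 := fun v hv ↦ by
    rw [hT, mem_filter, Set.Finite.mem_toFinset, Set.mem_setOf_eq] at hv; exact hv.1
  have hcT : ∀ v ∈ T, ‖χ₀ v‖ ≤ 1 := fun v hv ↦ by
    rw [hT, mem_filter] at hv; exact (hχ₀.norm_eq_one v hv.2).le
  set P : ℂ → ℂ := fun z ↦ ∏ v ∈ T, (1 - χ₀ v * ((Ideal.absNorm v.asIdeal : ℕ) : ℂ) ^ (-z)) with hP
  have hcpow : ∀ v : HeightOneSpectrum (𝓞 K),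
      Differentiable ℂ (fun z : ℂ ↦ ((Ideal.absNorm v.asIdeal : ℕ) : ℂ) ^ (-z)) := fun v z ↦ by
    refine DifferentiableAt.const_cpow differentiable_neg.differentiableAt (Or.inl ?_)
    exact_mod_cast (Nat.pos_of_ne_zero (by rw [Ne, Ideal.absNorm_eq_zero_iff]; exact v.ne_bot)).ne'
  have hfac : ∀ v ∈ T, Differentiable ℂ
      (fun z : ℂ ↦ 1 - χ₀ v * ((Ideal.absNorm v.asIdeal : ℕ) : ℂ) ^ (-z)) := fun v _ ↦
    (differentiable_const _).sub ((differentiable_const _).mul (hcpow v))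
  have hPd : Differentiable ℂ P := by
    rw [hP]; exact Differentiable.fun_finsetProd hfac
  -- the entire function `F(z) = (z - 1) L(z) P(z)`
  set F : ℂ → ℂ := fun z ↦ (z - 1) * L z * P z with hF
  have hFd : Differentiable ℂ F :=
    ((differentiable_id.sub (differentiable_const _)).mul hLd).mul hPd
  -- sizes
  set N𝔪 : ℝ := ((Ideal.absNorm 𝔪 : ℕ) : ℝ) with hN𝔪
  have hm0 : Ideal.absNorm 𝔪 ≠ 0 := by rwa [Ne, Ideal.absNorm_eq_zero_iff]
  have hN𝔪1 : 1 ≤ N𝔪 := by rw [hN𝔪]; exact_mod_cast Nat.pos_of_ne_zero hm0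
  have hN𝔣 : ((Ideal.absNorm 𝔣 : ℕ) : ℝ) ≤ N𝔪 := by
    have hdvd : Ideal.absNorm 𝔣 ∣ Ideal.absNorm 𝔪 := map_dvd Ideal.absNorm (Ideal.dvd_iff_le.mpr h𝔪𝔣)
    rw [hN𝔪]; exact_mod_cast Nat.le_of_dvd (Nat.pos_of_ne_zero hm0) hdvd
  have hdisc : |(discr K : ℝ)| = ((NumberField.discr K).natAbs : ℝ) := by
    rw [Nat.cast_natAbs, Int.cast_abs]
  set d : ℝ := ((NumberField.discr K).natAbs : ℝ) with hd
  set E : ℝ := Real.exp (2 * n) with hE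
  set M : ℝ := d * N𝔪 ^ 2 * Real.sqrt (Ideal.absNorm 𝔪 : ℕ) * E with hM
  have hM0 : 0 ≤ M := by positivity
  -- the `L`-series identity on `Re z > 1`
  have hψ1 : ∀ v : HeightOneSpectrum (𝓞 K), ¬ 𝔪 ≤ v.asIdeal → ‖ψ v‖ ≤ 1 := norm_charFun_le 𝔪 f χ
  have hLF : ∀ z : ℂ, 1 < z.re → LSeries (fun n ↦ ∑ I ∈ (Ideal.finite_setOf_absNorm_eq (S := 𝓞 K) n).toFinset,
      rayClassCoeff 𝔪 ψ I) z = F z / (z - 1) := by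
    intro z hz
    have hz1 : z - 1 ≠ 0 := sub_ne_zero.mpr fun h ↦ by rw [h, one_re] at hz; exact lt_irrefl _ hz
    rw [← rayClassLSeries_eq_LSeries h𝔪 hψ1 hz, hL z hz, ← hLs z hz, hF, hP]
    dsimp only
    field_simp
  -- the bound on `Re z ≥ -1/2`
  have hbd : ∀ z : ℂ, -1 / 2 ≤ z.re → ‖F z‖ ≤ M * ‖z + 5 / 2‖ ^ (n + 1) := by
    intro z hz
    have h1 := norm_sub_one_le_norm_add hz
    have h2 := hLb z hz
    rw [hdisc] at h2
    have h3 := norm_prod_one_sub_mul_cpow_le h𝔪 hTdvd hcT hz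
    rw [hF]; dsimp only
    rw [norm_mul, norm_mul]
    calc ‖z - 1‖ * ‖L z‖ * ‖P z‖
        ≤ ‖z + 5 / 2‖ * (d * ((Ideal.absNorm 𝔣 : ℕ) : ℝ) * E * ‖z + 5 / 2‖ ^ n) *
            (N𝔪 * Real.sqrt (Ideal.absNorm 𝔪 : ℕ)) := by
          gcongr
      _ ≤ ‖z + 5 / 2‖ * (d * N𝔪 * E * ‖z + 5 / 2‖ ^ n) * (N𝔪 * Real.sqrt (Ideal.absNorm 𝔪 : ℕ)) := by
          gcongr
      _ = M * ‖z + 5 / 2‖ ^ (n + 1) := by rw [hM]; ring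
  have hmain := norm_smoothedSum_sub_le hA (N := n + 1) (by omega) one_pos le_rfl
    (LSeriesSummable_sum_rayClassCoeff h𝔪 hψ1 (by norm_num)) hFd hLF hM0 hbd u
  have hF1 : F 1 = 0 := by rw [hF]; simp
  rw [hF1, sub_zero] at hmain
  rw [hM] at hmain
  convert hmain using 2

/-! ### The principal character: `L_𝔪(s, 1) = ζ_K(s) ∏_{𝔭∣𝔪}(1 − N𝔭^{-s})` -/

variable (K) in
/-- **`κ_K(𝔪) = κ_K ∏_{𝔭 ∣ 𝔪} (1 − N𝔭⁻¹)`** (`= κ_K φ(𝔪)/N𝔪`), the residue at `s = 1` of the zeta function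
`Σ_{(𝔞, 𝔪) = 1} N𝔞^{-s} = ζ_K(s) ∏_{𝔭∣𝔪}(1 − N𝔭^{-s})` of the ideals prime to `𝔪`; `h_𝔪⁻¹ κ_K(𝔪)` is the
common residue of the partial zeta functions of the narrow ray classes `mod 𝔪`. [folklore] -/
def coprimeResidue (𝔪 : Ideal (𝓞 K)) (h𝔪 : 𝔪 ≠ ⊥) : ℝ :=
  dedekindZeta_residue K * ∏ v ∈ (Ideal.finite_factors h𝔪).toFinset, (1 - ((Ideal.absNorm v.asIdeal : ℕ) : ℝ)⁻¹)

/-- The main term `κ_K φ(𝔪)/N𝔪` of Thorner–Zaman's Lemma 4.3 is positive. [cite: ThornerZaman2017, Lemma 4.3] -/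
theorem coprimeResidue_pos (h𝔪 : 𝔪 ≠ ⊥) : 0 < coprimeResidue K 𝔪 h𝔪 := by
  rw [coprimeResidue]
  refine mul_pos (dedekindZeta_residue_pos K) (prod_pos fun v _ ↦ ?_)
  have h2 : (2 : ℝ) ≤ (Ideal.absNorm v.asIdeal : ℕ) := by exact_mod_cast two_le_absNorm K v
  have : ((Ideal.absNorm v.asIdeal : ℕ) : ℝ)⁻¹ ≤ 1 / 2 := by
    rw [inv_eq_one_div]; exact div_le_div_of_nonneg_left zero_le_one (by norm_num) h2
  linarith

/-- **`L_𝔪(s, 1) = ζ_K(s) · ∏_{𝔭 ∣ 𝔪} (1 − N𝔭^{-s})`** for `Re s > 1`: the L-series of the principal character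
`mod 𝔪` is the Dedekind zeta function with the Euler factors at `𝔪` removed (Neukirch VII §8, (8.1) and the
remark before (8.5)). [cite: NeukirchANT1999, Ch. VII §8 (8.1)] -/
theorem rayClassLSeries_one_eq_dedekindZeta_mul_prod (h𝔪 : 𝔪 ≠ ⊥) {s : ℂ} (hs : 1 < s.re) :
    rayClassLSeries 𝔪 (fun _ ↦ (1 : ℂ)) s = dedekindZeta K s *
      ∏ v ∈ (Ideal.finite_factors h𝔪).toFinset, (1 - ((Ideal.absNorm v.asIdeal : ℕ) : ℂ) ^ (-s)) := by
  set T := (Ideal.finite_factors h𝔪).toFinset with hT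
  have hmemT : ∀ v, v ∈ T ↔ 𝔪 ≤ v.asIdeal := fun v ↦ by
    rw [hT, Set.Finite.mem_toFinset, Set.mem_setOf_eq, Ideal.dvd_iff_le]
  have h1 : ∀ v : HeightOneSpectrum (𝓞 K), ¬ 𝔪 ≤ v.asIdeal → ‖(fun _ ↦ (1 : ℂ)) v‖ ≤ 1 := fun v _ ↦ by simp
  have h1' : ∀ v : HeightOneSpectrum (𝓞 K), ¬ (⊤ : Ideal (𝓞 K)) ≤ v.asIdeal → ‖(fun _ ↦ (1 : ℂ)) v‖ ≤ 1 :=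
    fun v _ ↦ by simp
  have hG := hasProd_rayClassLSeries_rayClassPrimeValue h𝔪 h1 hs
  have hF := hasProd_rayClassLSeries_rayClassPrimeValue (top_ne_bot : (⊤ : Ideal (𝓞 K)) ≠ ⊥) h1' hs
  rw [rayClassLSeries_top_one_eq_dedekindZeta hs] at hF
  set N : HeightOneSpectrum (𝓞 K) → ℂ := fun v ↦ ((Ideal.absNorm v.asIdeal : ℕ) : ℂ) ^ (-s) with hN
  set H : HeightOneSpectrum (𝓞 K) → ℂ := fun v ↦ if v ∈ T then 1 - N v else 1 with hH
  have hH1 : HasProd H (∏ v ∈ T, H v) := hasProd_prod_of_ne_finset_one fun v hv ↦ by rw [hH]; exact if_neg hv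
  have hFH := hF.mul hH1
  have hpt : (fun v ↦ (1 - rayClassPrimeValue 𝔪 (fun _ ↦ (1 : ℂ)) v * ((Ideal.absNorm v.asIdeal : ℕ) : ℂ) ^ (-s))⁻¹) =
      fun v ↦ (1 - rayClassPrimeValue ⊤ (fun _ ↦ (1 : ℂ)) v * ((Ideal.absNorm v.asIdeal : ℕ) : ℂ) ^ (-s))⁻¹ * H v := by
    funext v
    have htop : ¬ (⊤ : Ideal (𝓞 K)) ≤ v.asIdeal := fun h ↦ v.isPrime.ne_top (top_le_iff.mp h)
    simp only [rayClassPrimeValue, hH, if_neg htop, one_mul]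
    by_cases hmv : 𝔪 ≤ v.asIdeal
    · have hne : (1 : ℂ) - N v ≠ 0 := by
        have := one_sub_mul_cpow_ne_zero (z := (1 : ℂ)) (by simp) v hs
        rwa [one_mul] at this
      rw [if_pos hmv, if_pos ((hmemT v).mpr hmv)]
      simp only [zero_mul, sub_zero, inv_one]
      rw [hN] at hne
      exact (inv_mul_cancel₀ hne).symm
    · rw [if_neg hmv, if_neg (fun h ↦ hmv ((hmemT v).mp h)), mul_one, one_mul]
  rw [hpt] at hG
  rw [hG.unique hFH]
  congr 1
  exact prod_congr rfl fun v hv ↦ by rw [hH]; exact if_pos hv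

/-- **Thorner–Zaman Lemma 4.3 for the principal character `mod 𝔪`** (`δ(χ) = 1`): with `m ≥ n_K + 3`,
`|Σ_{(𝔞,𝔪)=1} N𝔞^{-1} φ(u − log N𝔞) − κ_K φ(𝔪)/N𝔪| ≤ (1/3)·|d_K| N𝔪 √N𝔪 · e^{2n_K} · C · e^{−3u/2}`
(`C = majorConst A m (n_K+1)`; the Mellin shift with `F(z) = ζ₁_K(z) ∏_{𝔭∣𝔪}(1 − N𝔭^{-z})`,
`ζ₁_K(z) = (z−1)ζ_K(z)`, the tree's `norm_dedekindZeta₁_le`). [cite: ThornerZaman2017, Lemma 4.3] -/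
theorem norm_smoothedSum_one_sub_coprimeResidue_le (h𝔪 : 𝔪 ≠ ⊥) {A : ℝ} (hA : 0 < A) {m : ℕ}
    (hm : Module.finrank ℚ K + 3 ≤ m) (u : ℝ) :
    ‖smoothedSum (fun n ↦ ∑ I ∈ (Ideal.finite_setOf_absNorm_eq (S := 𝓞 K) n).toFinset,
        rayClassCoeff 𝔪 (fun _ ↦ (1 : ℂ)) I) A m u - coprimeResidue K 𝔪 h𝔪‖ ≤
      1 / 3 * ((((NumberField.discr K).natAbs : ℝ) * ((Ideal.absNorm 𝔪 : ℕ) : ℝ) *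
        Real.sqrt (Ideal.absNorm 𝔪 : ℕ)) * Real.exp (2 * Module.finrank ℚ K)) *
        majorConst A m (Module.finrank ℚ K + 1) * Real.exp (-(3 / 2 * u)) := by
  set n : ℕ := Module.finrank ℚ K with hn
  set T := (Ideal.finite_factors h𝔪).toFinset with hT
  have hTdvd : ∀ v ∈ T, v.asIdeal ∣ 𝔪 := fun v hv ↦ by
    rw [hT, Set.Finite.mem_toFinset, Set.mem_setOf_eq] at hv; exact hv
  set P : ℂ → ℂ := fun z ↦ ∏ v ∈ T, (1 - (1 : ℂ) * ((Ideal.absNorm v.asIdeal : ℕ) : ℂ) ^ (-z)) with hP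
  have hcpow : ∀ v : HeightOneSpectrum (𝓞 K),
      Differentiable ℂ (fun z : ℂ ↦ ((Ideal.absNorm v.asIdeal : ℕ) : ℂ) ^ (-z)) := fun v z ↦ by
    refine DifferentiableAt.const_cpow differentiable_neg.differentiableAt (Or.inl ?_)
    exact_mod_cast (Nat.pos_of_ne_zero (by rw [Ne, Ideal.absNorm_eq_zero_iff]; exact v.ne_bot)).ne'
  have hfac : ∀ v ∈ T, Differentiable ℂ
      (fun z : ℂ ↦ 1 - (1 : ℂ) * ((Ideal.absNorm v.asIdeal : ℕ) : ℂ) ^ (-z)) := fun v _ ↦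
    (differentiable_const _).sub ((differentiable_const _).mul (hcpow v))
  have hPd : Differentiable ℂ P := by
    rw [hP]; exact Differentiable.fun_finsetProd hfac
  set F : ℂ → ℂ := fun z ↦ dedekindZeta₁ K z * P z with hF
  have hFd : Differentiable ℂ F := (dedekindZeta₁_differentiable K).mul hPd
  set N𝔪 : ℝ := ((Ideal.absNorm 𝔪 : ℕ) : ℝ) with hN𝔪
  set d : ℝ := ((NumberField.discr K).natAbs : ℝ) with hd
  set E : ℝ := Real.exp (2 * n) with hE
  set M : ℝ := d * N𝔪 * Real.sqrt (Ideal.absNorm 𝔪 : ℕ) * E with hM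
  have hM0 : 0 ≤ M := by positivity
  have h1 : ∀ v : HeightOneSpectrum (𝓞 K), ¬ 𝔪 ≤ v.asIdeal → ‖(fun _ ↦ (1 : ℂ)) v‖ ≤ 1 := fun v _ ↦ by simp
  have hLF : ∀ z : ℂ, 1 < z.re → LSeries (fun n ↦ ∑ I ∈ (Ideal.finite_setOf_absNorm_eq (S := 𝓞 K) n).toFinset,
      rayClassCoeff 𝔪 (fun _ ↦ (1 : ℂ)) I) z = F z / (z - 1) := by
    intro z hz
    have hz1 : z - 1 ≠ 0 := sub_ne_zero.mpr fun h ↦ by rw [h, one_re] at hz; exact lt_irrefl _ hz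
    rw [← rayClassLSeries_eq_LSeries h𝔪 h1 hz, rayClassLSeries_one_eq_dedekindZeta_mul_prod h𝔪 hz, hF]
    dsimp only
    rw [dedekindZeta₁_apply_eq_mul hz, hP, hT]
    simp only [one_mul]
    field_simp
  have hbd : ∀ z : ℂ, -1 / 2 ≤ z.re → ‖F z‖ ≤ M * ‖z + 5 / 2‖ ^ (n + 1) := by
    intro z hz
    have h2 := norm_dedekindZeta₁_le (K := K) hz
    have h3 := norm_prod_one_sub_mul_cpow_le h𝔪 hTdvd (c := fun _ ↦ (1 : ℂ)) (fun v _ ↦ by simp) hz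
    rw [hF]; dsimp only
    rw [norm_mul]
    calc ‖dedekindZeta₁ K z‖ * ‖P z‖
        ≤ (d * E * ‖z + 5 / 2‖ ^ (n + 1)) * (N𝔪 * Real.sqrt (Ideal.absNorm 𝔪 : ℕ)) := by gcongr
      _ = M * ‖z + 5 / 2‖ ^ (n + 1) := by rw [hM]; ring
  have hmain := norm_smoothedSum_sub_le hA (N := n + 1) (by omega) one_pos le_rfl
    (LSeriesSummable_sum_rayClassCoeff h𝔪 h1 (by norm_num)) hFd hLF hM0 hbd u
  have hF1 : F 1 = (coprimeResidue K 𝔪 h𝔪 : ℂ) := by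
    rw [hF]; dsimp only
    rw [dedekindZeta₁_apply_one, coprimeResidue, hP]
    push_cast
    congr 1
    refine prod_congr rfl fun v _ ↦ ?_
    rw [one_mul, cpow_neg_one]
  rw [hF1, hM] at hmain
  convert hmain using 2

end Datum

end Literature.NumberTheory.LFunctions.AbelianDensity

end
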